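import Summits.AtomisticToContinuum.BoseEinsteinCondensation.Theorems.BECGroundStateSOSPeriodicIRBoundDifficultyFloor
import Summits.AtomisticToContinuum.BoseEinsteinCondensation.Theorems.PeriodicIRBound.Negative.GroundOccupation
import HarnessLib

/-!
# Crux `PeriodicIRBound` (stmt-AtomisticToContinuum-3972) — strategist seat p1 (wall-breaker), typed companion
# of `STRATEGY-CENSUS.md` (v2, supersedes seat s1's census of 03:02Z)

Every signature quoted in the census under the four headings is a declaration of THIS file (or of the
landed tree, named there with its p-id).  Nothing here is a route item and nothing here restates the crux:
the file TYPES (i) the weakening direction S⁻ that the census recommends to the TENURE planner (the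
strategist never weakens a crux): the window-sum form `WindowSumIRBound` — which is all the route's own
mode counting `IRModeCounting` consumes — and the exponent-2 companion `PeriodicIRBound₂`
(triage r2-1 "sharpen"), with the trivial implications FROM the crux; (ii) the best new typed split found,
D7 "block zone / ultraviolet" (`BlockIRThermo`, `UVOccupationBound`, glue `BlockZoneUVGlue`), whose
ultraviolet piece is where the crux's PER-MODE form re-enters (census §2 "per-mode virality");
(iii) the strengthening S⁺4 `QuasiMonotoneOccupations`; (iv) the negation target in ground-state form
(landed `GroundIRBoundWith`, cited).  All proofs below are compositions / monotonicity; no `sorry`.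

References: [LSSY2005] Lieb–Seiringer–Solovej–Yngvason, *The Mathematics of the Bose Gas and its
Condensation* (2005), Ch. 5, Ch. 11; [KLS1988JSP] Kennedy–Lieb–Shastry, J. Stat. Phys. 53 (1988) 1019;
[WojtkiewiczPuszStachura2016] (quantum-rotor RP, cited via route BECIntegerBlockRotor).
-/

noncomputable section

open MeasureTheory Filter
open scoped ENNReal NNReal BigOperators Classical

namespace Summit.AtomisticToContinuum.BoseEinsteinCondensation.Cruxes.PeriodicIRBound.StrategistP1

open Literature.MathematicalPhysics.QuantumManyBody.BoseGas
open Summit.AtomisticToContinuum.BoseEinsteinCondensation.Theses.BECGroundStateSOS (PeriodicIRBound)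
open Summit.AtomisticToContinuum.BoseEinsteinCondensation.Theorems.PeriodicIRBound.Negative
  (NearMin InWindow IRIneq IRBoundFor periodicIRBound_iff irIneq_iff GroundIRBoundWith
    irBoundFor_iff_ground)
open Summit.AtomisticToContinuum.BoseEinsteinCondensation.Cruxes.GDTransfer.DysonDressedWitness (PeriodicBECFor)
open Summit.AtomisticToContinuum.BoseEinsteinCondensation.Cruxes.PeriodicIRBound.DifficultyFloor
  (periodicBECFor_of_periodicIRBound)

/-! ## §1  S⁻ — the weakening direction (route-level recommendation, NOT a strategist move)

The route consumes `PeriodicIRBound` only through `IRModeCounting` (stmt-4246; per potential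
`LandauToPeriodicBEC.periodicBEC_of_irBoundFor`, p99222), and that proof uses the per-mode bound ONLY
summed over the window (harmonic shell sum `∑_{0<‖k‖_∞≤M} 1/‖k‖_∞ ≤ 26M²`).  The window-SUM form below
therefore feeds the route's `closes` verbatim, is implied by the crux, and — unlike the crux — is a SUM
statement, i.e. of the kind that block / energy / reflection-positivity-after-blocking mechanisms deliver. -/

/-- The finite momentum window `{k ∈ ℤ³ : k ≠ 0, ‖k‖_∞ ≤ κ√ρ L_N}` as a `Finset`
(inside the box `[-R,R]³`, `R = ⌈κ√ρ L_N⌉`, cf. landed `Negative.inWindow_mem_box`). -/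
def windowSet (κ ρ : ℝ) (N : ℕ) : Finset (Fin 3 → ℤ) :=
  (Fintype.piFinset fun _ : Fin 3 =>
      Finset.Icc (-((⌈κ * Real.sqrt ρ * sideLength ρ N⌉₊ : ℕ) : ℤ))
        ((⌈κ * Real.sqrt ρ * sideLength ρ N⌉₊ : ℕ) : ℤ)).filter
    fun k => InWindow κ ρ N k

/-- The total occupation of the window, `∑_{0<‖k‖_∞≤κ√ρL_N} n_k(Ψ)`. -/
def windowOccupation (κ ρ : ℝ) (N : ℕ) (Ψ : Config N → ℂ) : ℝ≥0∞ :=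
  ∑ k ∈ windowSet κ ρ N, cellOccupation N (sideLength ρ N) (planeWaveMode (sideLength ρ N) k) Ψ

/-- **X_Σ for one potential** — the WINDOW-SUM infrared bound: the window carries at most
`C κ² √ρ N` particles of every `δ_N`-near-minimiser (what summing `C√ρL/‖k‖` over the window gives,
and all that mode counting uses).  Equivalent in strength to torus BEC with depletion rate `O(√ρ)`
into the window. -/
def WindowSumFor (v : ℝ → ℝ≥0∞) : Prop :=
  ∀ κ : ℝ, 0 < κ → ∃ ρ₀ : ℝ, 0 < ρ₀ ∧ ∃ C : ℝ, 0 < C ∧ ∀ ρ : ℝ, 0 < ρ → ρ < ρ₀ →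
    ∀ᶠ N : ℕ in atTop, ∃ δ : ℝ≥0∞, 0 < δ ∧ ∀ Ψ : PeriodicTrialState N (sideLength ρ N),
      NearMin v ρ N δ Ψ →
        windowOccupation κ ρ N Ψ.ψ ≤ ENNReal.ofReal (C * κ ^ 2 * Real.sqrt ρ * N)

/-- **X_Σ** (recommended restatement (b) of crux #3; feeds `IRModeCounting` without the shell sum). -/
def WindowSumIRBound : Prop :=
  ∀ v : ℝ → ℝ≥0∞, IsRepulsiveFiniteRange v → WindowSumFor v

/-- The exponent-2 infrared inequality `n_k ≤ C(√ρ L/‖k‖ + ρL²/‖k‖²)` (the shape the Kennedy–Lieb–Shastry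
transfer gives from Gaussian domination ALONE, without the convexity input stmt-9094; = stmt-12624 of
route BECTwoSectorGD on the diagonal `L = L_N`). -/
def IRIneq₂ (C ρ : ℝ) (N : ℕ) (Ψ : Config N → ℂ) (k : Fin 3 → ℤ) : Prop :=
  cellOccupation N (sideLength ρ N) (planeWaveMode (sideLength ρ N) k) Ψ ≤
    ENNReal.ofReal (C * (Real.sqrt ρ * sideLength ρ N / ‖(fun j => (k j : ℝ))‖ +
      ρ * sideLength ρ N ^ 2 / ‖(fun j => (k j : ℝ))‖ ^ 2))

/-- **X₂ for one potential** (same quantifier shell as `IRBoundFor`). -/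
def IRBoundFor₂ (v : ℝ → ℝ≥0∞) : Prop :=
  ∀ κ : ℝ, 0 < κ → ∃ ρ₀ : ℝ, 0 < ρ₀ ∧ ∃ C : ℝ, 0 < C ∧ ∀ ρ : ℝ, 0 < ρ → ρ < ρ₀ →
    ∀ᶠ N : ℕ in atTop, ∃ δ : ℝ≥0∞, 0 < δ ∧ ∀ Ψ : PeriodicTrialState N (sideLength ρ N),
      NearMin v ρ N δ Ψ → ∀ k : Fin 3 → ℤ, InWindow κ ρ N k → IRIneq₂ C ρ N Ψ.ψ k

/-- **X₂** (recommended restatement (a) of crux #3, triage r2-1 "sharpen": closes on stmt-12620 alone via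
the landed KLS transfer; still feeds mode counting since `∑_window ρL²/‖k‖² ≍ κ√ρ·N = o(N)`). -/
def PeriodicIRBound₂ : Prop :=
  ∀ v : ℝ → ℝ≥0∞, IsRepulsiveFiniteRange v → IRBoundFor₂ v

/-- The crux's inequality implies the exponent-2 inequality with the same constant. [folklore] -/
theorem irIneq₂_of_irIneq {C ρ : ℝ} (hC : 0 ≤ C) (hρ : 0 ≤ ρ) {N : ℕ} {Ψ : Config N → ℂ}
    {k : Fin 3 → ℤ} (h : IRIneq C ρ N Ψ k) : IRIneq₂ C ρ N Ψ k := by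
  rw [irIneq_iff] at h
  unfold IRIneq₂
  refine h.trans (ENNReal.ofReal_le_ofReal ?_)
  have hb : 0 ≤ ρ * sideLength ρ N ^ 2 / ‖(fun j => (k j : ℝ))‖ ^ 2 := by positivity
  have : C * (Real.sqrt ρ * sideLength ρ N / ‖(fun j => (k j : ℝ))‖) ≤
      C * (Real.sqrt ρ * sideLength ρ N / ‖(fun j => (k j : ℝ))‖ +
        ρ * sideLength ρ N ^ 2 / ‖(fun j => (k j : ℝ))‖ ^ 2) :=
    mul_le_mul_of_nonneg_left (le_add_of_nonneg_right hb) hC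
  calc C * Real.sqrt ρ * sideLength ρ N / ‖(fun j => (k j : ℝ))‖
      = C * (Real.sqrt ρ * sideLength ρ N / ‖(fun j => (k j : ℝ))‖) := by ring
    _ ≤ _ := this

/-- `X ⇒ X₂` per potential. [folklore] -/
theorem irBoundFor₂_of_irBoundFor {v : ℝ → ℝ≥0∞} (h : IRBoundFor v) : IRBoundFor₂ v := by
  intro κ hκ
  obtain ⟨ρ₀, hρ₀, C, hC, h⟩ := h κ hκ
  refine ⟨ρ₀, hρ₀, C, hC, fun ρ hρ hρρ₀ => ?_⟩
  filter_upwards [h ρ hρ hρρ₀] with N ⟨δ, hδ, hN⟩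
  exact ⟨δ, hδ, fun Ψ hΨ k hk => irIneq₂_of_irIneq hC.le hρ.le (hN Ψ hΨ k hk)⟩

/-- `X ⇒ X₂`. [folklore] -/
theorem periodicIRBound₂_of_periodicIRBound (h : PeriodicIRBound) : PeriodicIRBound₂ :=
  fun v hv => irBoundFor₂_of_irBoundFor (periodicIRBound_iff.mp h v hv)

/-- The floor is unchanged by the weakening in the only direction that matters for staffing: the crux
implies torus BEC for every admissible potential (landed `DifficultyFloor`, p132197); recorded here so the
census can cite one declaration for "X ≥ summit(torus form)". [folklore] -/
theorem floor_of_crux (h : PeriodicIRBound) : ∀ v : ℝ → ℝ≥0∞, IsRepulsiveFiniteRange v → PeriodicBECFor v :=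
  periodicBECFor_of_periodicIRBound h

/-! ## §2  D7 — the block-zone / ultraviolet split (best new typed decomposition; NOT filed)

Blocks of side `ℓ = L_N/K ∈ [A, 2A]·ρ^{-1/2}` (no divisibility / integer-filling hypothesis: the
thermodynamic box, all large `N`).  `blockWave L K q` is the normalised block plane wave
`f_q(x) = L^{-3/2} exp(2πi q·⌊Kx/L⌋/K)`; `blockDispersion K q = ε_K(q) = ∑_j (1 - cos(2πq_j/K))`. -/

/-- The block-lattice phase `q · b(x)`, `b_j(x) = ⌊K x_j/L⌋`. -/
def blockPhase (L : ℝ) (K : ℕ) (q : Fin 3 → ℤ) (x : Space) : ℝ :=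
  ∑ j : Fin 3, (q j : ℝ) * ((⌊(K : ℝ) * x j / L⌋ : ℤ) : ℝ)

/-- The normalised block plane wave `f_q` of the `K³`-blocking of the torus of side `L`. -/
def blockWave (L : ℝ) (K : ℕ) (q : Fin 3 → ℤ) : Space → ℂ :=
  fun x => ((Real.sqrt (L ^ 3))⁻¹ : ℂ) *
    Complex.exp (2 * Real.pi * Complex.I * ((blockPhase L K q x : ℝ) : ℂ) / ((K : ℝ) : ℂ))

/-- The block-lattice dispersion `ε_K(q) = ∑_j (1 - cos(2π q_j/K))`. -/
def blockDispersion (K : ℕ) (q : Fin 3 → ℤ) : ℝ :=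
  ∑ j : Fin 3, (1 - Real.cos (2 * Real.pi * (q j : ℝ) / K))

/-- **D7, infrared piece `BlockIRThermo`** — the Kennedy–Lieb–Shastry-shaped bound for BLOCK waves in the
thermodynamic box: for each admissible `v` there is ONE block constant `A` such that every
`δ_N`-near-minimiser has `n(f_q) ≤ C/√ε_K(q)` for every blocking `K` with `L_N/K ∈ [A,2A]ρ^{-1/2}` and every
`q ≢ 0 (mod K)`.  (Route BECIntegerBlockRotor's `BlockInfraredBound`, stmt of crux dir `BlockInfraredBound`,
asserts this box-uniformly but ONLY for integer-filled blockings `K³ ∣ N`; the thermodynamic-box form for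
all large `N` needs in addition a per-mode doping step — census §Decomposition D7.) -/
def BlockIRThermo : Prop :=
  ∀ v : ℝ → ℝ≥0∞, IsRepulsiveFiniteRange v → ∃ A : ℝ, 0 < A ∧ ∃ ρ₀ : ℝ, 0 < ρ₀ ∧ ∃ C : ℝ, 0 < C ∧
    ∀ ρ : ℝ, 0 < ρ → ρ < ρ₀ → ∀ᶠ N : ℕ in atTop, ∃ δ : ℝ≥0∞, 0 < δ ∧
      ∀ Ψ : PeriodicTrialState N (sideLength ρ N), NearMin v ρ N δ Ψ →
        ∀ K : ℕ, 0 < K → A / Real.sqrt ρ ≤ sideLength ρ N / K →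
          sideLength ρ N / K ≤ 2 * A / Real.sqrt ρ →
            ∀ q : Fin 3 → ℤ, (¬ ∀ j, (K : ℤ) ∣ q j) →
              cellOccupation N (sideLength ρ N) (blockWave (sideLength ρ N) K q) Ψ.ψ ≤
                ENNReal.ofReal (C / Real.sqrt (blockDispersion K q))

/-- **D7, ultraviolet piece `UVOccupationBound`** — O(1) occupation of EVERY single plane wave above the
block scale: for each admissible `v` and EVERY `A > 0`, eventually every `δ_N`-near-minimiser has
`n_k ≤ C(v, A)` for all `‖k‖_∞ ≥ √ρ L_N/A` (physical momenta `|p| ≳ 2π√ρ/A`, the healing scale and above).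
It carries no condensation content (true for the free gas with a density-size slack) — its difficulty is
purely the PER-MODE resolution (census §2): no energy method bounds a single ultraviolet mode below
`aA²N`, and a susceptibility proof needs the Landau sector floor at momentum `√ρ/A`. -/
def UVOccupationBound : Prop :=
  ∀ v : ℝ → ℝ≥0∞, IsRepulsiveFiniteRange v → ∀ A : ℝ, 0 < A → ∃ ρ₀ : ℝ, 0 < ρ₀ ∧ ∃ C : ℝ, 0 < C ∧
    ∀ ρ : ℝ, 0 < ρ → ρ < ρ₀ → ∀ᶠ N : ℕ in atTop, ∃ δ : ℝ≥0∞, 0 < δ ∧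
      ∀ Ψ : PeriodicTrialState N (sideLength ρ N), NearMin v ρ N δ Ψ →
        ∀ k : Fin 3 → ℤ, Real.sqrt ρ * sideLength ρ N / A ≤ ‖(fun j => (k j : ℝ))‖ →
          cellOccupation N (sideLength ρ N) (planeWaveMode (sideLength ρ N) k) Ψ.ψ ≤
            ENNReal.ofReal C

/-- **D7, the glue** (paper proof in the census: translation averaging `n_k(Ψ) = ⨍_a n_k(T_aΨ)`,
aliasing `e_k = s_k f_k + g_k` with `supp ĝ_k ⊂ k + Kℤ³`, `‖g_k‖² = 1 - |s_k|² ≤ c(‖k‖/K)²`, the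
quadratic-form splitting `n(αf+g) ≤ 2|α|²n(f) + 2n(g)` and `ε_K(k) ≥ 8‖k‖_∞²/K²`): L-sized Lean, provable
now, NOT proved here.  Stated as a proposition so that the census's claim "D7 is a split of X" is a
typed object; it is the only executable content a line on D7 would give a lead. -/
def BlockZoneUVGlue : Prop := BlockIRThermo → UVOccupationBound → PeriodicIRBound

/-! ## §3  S⁺4 — quasi-monotone occupations (would turn ball sums into per-mode bounds; no mechanism) -/

/-- **S⁺4 `QuasiMonotoneOccupations`**: inside the window, occupations of near-minimisers do not increase
outward by more than a factor `M`: `‖k‖_∞ ≤ ‖k'‖_∞ ⇒ n_{k'} ≤ M n_k` (Bogoliubov: `v_p²` is radially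
decreasing).  With it, the BALL sums that block mechanisms control would give the crux
(`n_k ≤ M·(ball sum)/(#shell)`); it is itself a per-mode COMPARISON with no variational handle. -/
def QuasiMonotoneOccupations : Prop :=
  ∀ v : ℝ → ℝ≥0∞, IsRepulsiveFiniteRange v → ∀ κ : ℝ, 0 < κ → ∃ ρ₀ : ℝ, 0 < ρ₀ ∧ ∃ M : ℝ, 0 < M ∧
    ∀ ρ : ℝ, 0 < ρ → ρ < ρ₀ → ∀ᶠ N : ℕ in atTop, ∃ δ : ℝ≥0∞, 0 < δ ∧
      ∀ Ψ : PeriodicTrialState N (sideLength ρ N), NearMin v ρ N δ Ψ →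
        ∀ k k' : Fin 3 → ℤ, InWindow κ ρ N k → InWindow κ ρ N k' →
          ‖(fun j => (k j : ℝ))‖ ≤ ‖(fun j => (k' j : ℝ))‖ →
            cellOccupation N (sideLength ρ N) (planeWaveMode (sideLength ρ N) k') Ψ.ψ ≤
              ENNReal.ofReal M *
                cellOccupation N (sideLength ρ N) (planeWaveMode (sideLength ρ N) k) Ψ.ψ

/-! ## §4  Negation target in ground-state form (landed, cited)

`Negative.irBoundFor_iff_ground` (p73804): per potential the crux is equivalent (factor 2 in `C`) to the
slack-free bound on `groundOccupation v N L_N k = ⨅_{δ>0} ⨆_{δ-near-min} n_k` — for every `(N, L)` with a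
Perron–Frobenius-unique ground state this is `n_k(Ψ₀)`.  A counterexample to the crux is therefore an
admissible `v` whose torus GROUND STATES violate Bogoliubov's `1/|p|` law frequently in `N`; no computable
state is a witness (census §Negation). -/

/-- The negation, unfolded to ground-state occupations (composition of landed equivalences). [folklore] -/
theorem not_periodicIRBound_iff_ground :
    ¬ PeriodicIRBound ↔ ∃ v : ℝ → ℝ≥0∞, IsRepulsiveFiniteRange v ∧
      ¬ (∀ κ : ℝ, 0 < κ → ∃ ρ₀ : ℝ, 0 < ρ₀ ∧ ∃ C : ℝ, 0 < C ∧ GroundIRBoundWith v κ ρ₀ C) := by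
  rw [periodicIRBound_iff]
  constructor
  · intro h
    by_contra hne
    apply h
    intro v hv
    rw [irBoundFor_iff_ground]
    by_contra hG
    exact hne ⟨v, hv, hG⟩
  · rintro ⟨v, hv, hnot⟩ h
    exact hnot ((irBoundFor_iff_ground v).1 (h v hv))

end Summit.AtomisticToContinuum.BoseEinsteinCondensation.Cruxes.PeriodicIRBound.StrategistP1

end
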